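import Literature.AlgebraicGeometry.Kawanoue2007.IdealisticFiltration
import Mathlib.RingTheory.Localization.AtPrime.Basic
import Mathlib.RingTheory.Localization.Ideal
import Mathlib.RingTheory.AdicCompletion.Algebra
import HarnessLib

/-!
# Kawanoue 2007, Part I, §2.4.1: localization and completion of an idealistic filtration; Prop. 2.4.2.1 (1)

H. Kawanoue, *Toward resolution of singularities over a field of positive characteristic. Part I. Foundation;
the language of the idealistic filtration*, Publ. RIMS **43** (2007) 819–909 (= arXiv:math/0607009) [Kawanoue2007],
§2.4 «Localization and completion of an idealistic filtration», read on the held arXiv text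
(`lit read paper:arxiv-math-0607009`, chunk p0072 L5–L33 = Definition 2.4.1.1, Remark 2.4.1.2, Proposition 2.4.2.1
(1); chunk p0073 L1–L24 = Proposition 2.4.2.1 (2) and its proof). Sequel of `IdealisticFiltration.lean` (Def. 2.1.1.1,
`generate`), which left §2.4 «deliberately NOT here». Campaign `res-hironaka` (D-0089), rung LIT-6; typed now because
the Part II statements about the invariants AT A CLOSED POINT `P` (Kawanoue–Matsuki 2010: `σ(P)`, `μ̃(P)` are read on
the localization `𝕀_P`; Prop. 3.1.2.1, Prop. 3.3.1.1, Thm. A.1.1.1) need the localization `𝕀_P` of a filtration given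
over the coordinate ring. VOCABULARY file: REAL definitions with elementary API PROVED, and Proposition 2.4.2.1 (1)
PROVED; NO named facts; nothing of Hironaka's 2017 manuscript is referred to or asserted.

## What is typed, and how (faithfulness notes)

* **Def. 2.4.1.1 (1)(2)** (p0072 L7–L21): «(Localization) Let `S` be a multiplicative set of `R`. Consider the subset
  `𝕀_S ⊂ R_S × ℝ` defined by `(𝕀_S)_a = (𝕀_a)_S = 𝕀_a ⊗_R R_S` (`a ∈ ℝ`). Then `𝕀_S` is an idealistic filtration,
  called the localization of `𝕀` by `S`. … with `S = R ∖ P`, we often denote `𝕀_S` by `𝕀_P`. (2) (Completion) …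
  `(𝕀̂)_a = 𝕀̂_a = 𝕀_a ⊗_R R̂` … called the completion of `𝕀`». Both are «extend every level along a ring map»: we
  type ONE operation `IdealisticFiltration.map φ 𝕀` for a ring homomorphism `φ : R →+* S`, with levels
  `(𝕀.map φ)_a = φ(𝕀_a)S` (`Ideal.map`), and name the two printed instances `localization M 𝕀`
  (`φ = algebraMap R (Localization M)`; `atPrime P 𝕀 = 𝕀_P`) and `adicCompletion 𝔪 𝕀` (`φ = R → R̂ =
  AdicCompletion 𝔪 R`). For these FLAT maps (`R` noetherian in print) the extended ideal `𝕀_a R_S`, `𝕀_a R̂` IS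
  `𝕀_a ⊗_R R_S`, `𝕀_a ⊗_R R̂`, so this is the printed object; for a general `φ` it is the natural extension and
  nothing printed depends on it. `map` is typed for any target satisfying `IsLocalization` as well
  (`mem_level_map_iff_of_isLocalization`: `g ∈ (𝕀_S)_a ⟺ g·s = f` for some `f ∈ 𝕀_a`, `s ∈ S`).
* **Restriction** `comap φ 𝕁` (levels `φ⁻¹(𝕁_a)`): the operation «`𝕁 ∩ (R × ℝ)`» used in the printed proof of
  Prop. 2.4.2.1 (2) (p0073 L9: «`𝔇(𝕀_S) ∩ {R × ℝ}` is an idealistic filtration over `R` containing `𝕀`»); `map φ` and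
  `comap φ` are adjoint for the inclusion `Incl` (`map_incl_iff_incl_comap`).
* **Rem. 2.4.1.2, (1) ⇒ (2)/(3)**: `𝕀 ⊂ 𝕀' ⇒ 𝕀_𝔪 ⊂ 𝕀'_𝔪` and `𝕀̂ ⊂ 𝕀̂'` (`Incl.map`). The converse
  («(2) for every maximal `𝔪` ⇒ (1)», a standard local-global statement) is not needed and not typed.
* **Prop. 2.4.2.1 (1)** (p0072 L33 – p0073 L1): «(Compatibility with generation) Let `T ⊂ R × ℝ` be a subset. Then
  `G_R(T)_S = G_{R_S}(T)`, `Ĝ_R(T) = G_{R̂}(T)`» — PROVED for every ring map as `map_generate`: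
  `(G(T)).map φ = G(φ(T))`, `φ(T) = {(φ f, a) ; (f, a) ∈ T}`; the printed proof («follows easily from the explicit
  construction of the generation in Lemma 2.2.1.2 (1)») is replaced by the adjunction with `comap` (shorter in
  Lean; same content). «In particular, if `𝕀 = G(T)` is of r.f.g. type, then so are `𝕀_S` and `𝕀̂`» = `IsRFG.map`.

Deliberately NOT here: Prop. 2.4.2.1 (2)(3) (compatibility with 𝔇- and ℜ-saturation — (2) needs the extension of
differential operators to `R_S`/`R̂`, Lemma 1.1.2.1 (7); (3) needs r.f.g. type and the integral-closure description),
Cor. 2.4.2.3, the pointwise invariants of Part II (they are typed where used). Nothing of Hironaka's 2017 manuscript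
is referred to or asserted.

## References

* H. Kawanoue, Publ. RIMS 43 (2007) 819–909 = arXiv:math/0607009: Def. 2.4.1.1, Rem. 2.4.1.2, Prop. 2.4.2.1 (1)
  (and the restriction `∩ (R × ℝ)` in the proof of Prop. 2.4.2.1 (2)). [Kawanoue2007]
-/

namespace Literature.AlgebraicGeometry.Kawanoue2007

namespace IdealisticFiltration

variable {R S S' : Type*} [CommRing R] [CommRing S] [CommRing S']

/-! ## Def. 2.4.1.1: extension of an idealistic filtration along a ring map; localization; completion -/

/-- **Extension of an idealistic filtration along a ring homomorphism** `φ : R → S`: the filtration over `S` with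
levels `(𝕀.map φ)_a = φ(𝕀_a) S` (the extended ideals). For `φ = R → R_S` this is Kawanoue's localization
«`(𝕀_S)_a = (𝕀_a)_S = 𝕀_a ⊗_R R_S`», for `φ = R → R̂` his completion «`(𝕀̂)_a = 𝕀_a ⊗_R R̂`» (Def. 2.4.1.1 (1)(2);
for these flat maps the extended ideal is the base change). Conditions (o), (ii), (iii) of Def. 2.1.1.1 are preserved
by `Ideal.map`. [cite: Kawanoue2007, Def. 2.4.1.1] -/
def map (φ : R →+* S) (𝕀 : IdealisticFiltration R) : IdealisticFiltration S where
  level a := (𝕀.level a).map φ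
  level_zero := by rw [𝕀.level_zero, Ideal.map_top]
  mul_le a b := by
    rw [← Ideal.map_mul]
    exact Ideal.map_mono (𝕀.mul_le a b)
  antitone _ _ hab := Ideal.map_mono (𝕀.antitone hab)

/-- The levels of the extension: `(𝕀.map φ)_a = φ(𝕀_a)S`. [cite: Kawanoue2007, Def. 2.4.1.1] -/
@[simp] theorem level_map (φ : R →+* S) (𝕀 : IdealisticFiltration R) (a : ℝ) :
    (𝕀.map φ).level a = (𝕀.level a).map φ := rfl

/-- `(f, a) ∈ 𝕀 ⇒ (φ f, a) ∈ 𝕀.map φ`. [cite: Kawanoue2007, Def. 2.4.1.1] -/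
theorem mem_level_map_of_mem (φ : R →+* S) (𝕀 : IdealisticFiltration R) {a : ℝ} {f : R}
    (hf : f ∈ 𝕀.level a) : φ f ∈ (𝕀.map φ).level a :=
  Ideal.mem_map_of_mem φ hf

/-- The image of the printed subset `𝕀 ⊂ R × ℝ` lies in `𝕀.map φ ⊂ S × ℝ`. [cite: Kawanoue2007, Def. 2.4.1.1] -/
theorem image_carrier_subset_carrier_map (φ : R →+* S) (𝕀 : IdealisticFiltration R) :
    Prod.map φ id '' 𝕀.carrier ⊆ (𝕀.map φ).carrier := by
  rintro _ ⟨⟨f, a⟩, hf, rfl⟩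
  have h : f ∈ 𝕀.level a := hf
  show φ f ∈ (𝕀.level a).map φ
  exact Ideal.mem_map_of_mem φ h

/-- Extension along the identity does nothing. [cite: Kawanoue2007, Def. 2.4.1.1] -/
@[simp] theorem map_id (𝕀 : IdealisticFiltration R) : 𝕀.map (RingHom.id R) = 𝕀 :=
  ext fun a => by simp [Ideal.map_id]

/-- Extension is functorial: `(𝕀.map φ).map ψ = 𝕀.map (ψ ∘ φ)` (e.g. localize, then complete).
[cite: Kawanoue2007, Def. 2.4.1.1] -/
theorem map_map (φ : R →+* S) (ψ : S →+* S') (𝕀 : IdealisticFiltration R) :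
    (𝕀.map φ).map ψ = 𝕀.map (ψ.comp φ) :=
  ext fun a => by simp [Ideal.map_map]

/-- **Rem. 2.4.1.2, (1) ⇒ (2)/(3)**: `𝕀 ⊂ 𝕀' ⇒ 𝕀_S ⊂ 𝕀'_S` (and `𝕀̂ ⊂ 𝕀̂'`), for any extension.
[cite: Kawanoue2007, Rem. 2.4.1.2] -/
theorem Incl.map (φ : R →+* S) {𝕀 𝕀' : IdealisticFiltration R} (h : Incl 𝕀 𝕀') :
    Incl (𝕀.map φ) (𝕀'.map φ) :=
  fun a => Ideal.map_mono (h a)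

/-- **Restriction along `φ`**: the filtration over `R` with levels `φ⁻¹(𝕁_a)` — the printed «`𝕁 ∩ (R × ℝ)`» for
`R ⊂ R_S` (proof of Prop. 2.4.2.1 (2): «`𝔇(𝕀_S) ∩ {R × ℝ}` is an idealistic filtration over `R` containing `𝕀`»).
[cite: Kawanoue2007, Prop. 2.4.2.1 (2), proof] -/
def comap (φ : R →+* S) (𝕁 : IdealisticFiltration S) : IdealisticFiltration R where
  level a := (𝕁.level a).comap φ
  level_zero := by rw [𝕁.level_zero, Ideal.comap_top]
  mul_le a b := (Ideal.le_comap_mul φ).trans (Ideal.comap_mono (𝕁.mul_le a b))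
  antitone _ _ hab := Ideal.comap_mono (𝕁.antitone hab)

/-- The levels of the restriction. [cite: Kawanoue2007, Prop. 2.4.2.1 (2), proof] -/
@[simp] theorem level_comap (φ : R →+* S) (𝕁 : IdealisticFiltration S) (a : ℝ) :
    (𝕁.comap φ).level a = (𝕁.level a).comap φ := rfl

/-- `(f, a) ∈ 𝕁 ∩ (R × ℝ) ⟺ (φ f, a) ∈ 𝕁`. [cite: Kawanoue2007, Prop. 2.4.2.1 (2), proof] -/
theorem mem_level_comap_iff (φ : R →+* S) (𝕁 : IdealisticFiltration S) {a : ℝ} {f : R} :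
    f ∈ (𝕁.comap φ).level a ↔ φ f ∈ 𝕁.level a := Ideal.mem_comap

/-- **Extension ⊣ restriction**: `𝕀.map φ ⊂ 𝕁 ⟺ 𝕀 ⊂ 𝕁 ∩ (R × ℝ)` (levelwise `Ideal.map_le_iff_le_comap`).
[cite: Kawanoue2007, Def. 2.4.1.1 with Prop. 2.4.2.1 (2), proof] -/
theorem map_incl_iff_incl_comap (φ : R →+* S) {𝕀 : IdealisticFiltration R} {𝕁 : IdealisticFiltration S} :
    Incl (𝕀.map φ) 𝕁 ↔ Incl 𝕀 (𝕁.comap φ) :=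
  forall_congr' fun _ => Ideal.map_le_iff_le_comap

/-- `𝕀 ⊂ (𝕀.map φ) ∩ (R × ℝ)` («containing `𝕀`», p0073 L9). [cite: Kawanoue2007, Prop. 2.4.2.1 (2), proof] -/
theorem incl_comap_map (φ : R →+* S) (𝕀 : IdealisticFiltration R) : Incl 𝕀 ((𝕀.map φ).comap φ) :=
  (map_incl_iff_incl_comap φ).mp Incl.rfl

/-- `(𝕁 ∩ (R × ℝ)).map φ ⊂ 𝕁` («hence `(𝔇(𝕀)_a)_S ⊂ 𝔇(𝕀_S)_a`», p0073 L11). [cite: Kawanoue2007, Prop. 2.4.2.1 (2), proof] -/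
theorem map_comap_incl (φ : R →+* S) (𝕁 : IdealisticFiltration S) : Incl ((𝕁.comap φ).map φ) 𝕁 :=
  (map_incl_iff_incl_comap φ).mpr Incl.rfl

/-! ## Prop. 2.4.2.1 (1): compatibility of generation with localization / completion -/

/-- **Prop. 2.4.2.1 (1) (compatibility with generation)**: «Let `T ⊂ R × ℝ` be a subset. Then
`G_R(T)_S = G_{R_S}(T)`, `Ĝ_R(T) = G_{R̂}(T)`» — for every extension: `G(T).map φ = G(φ(T))` with
`φ(T) = {(φ f, a) ; (f, a) ∈ T}`. (Printed proof: from the explicit generators of Lemma 2.2.1.2 (1); here: `⊇` because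
`φ(T) ⊂ G(T).map φ`, `⊆` by the adjunction with the restriction, since `T ⊂ G(φ(T)) ∩ (R × ℝ)`.)
[cite: Kawanoue2007, Prop. 2.4.2.1 (1)] -/
theorem map_generate (φ : R →+* S) (T : Set (R × ℝ)) :
    (generate T).map φ = generate (Prod.map φ id '' T) := by
  apply Incl.antisymm
  · -- `⊆`: by the adjunction it suffices that `T ⊂ G(φ(T)) ∩ (R × ℝ)`
    rw [map_incl_iff_incl_comap]
    apply generate_incl
    rintro ⟨f, a⟩ hfa
    have h : (φ f, a) ∈ (generate (Prod.map φ id '' T)).carrier :=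
      subset_carrier_generate _ ⟨(f, a), hfa, rfl⟩
    exact h
  · -- `⊇`: `φ(T) ⊂ G(T).map φ`
    apply generate_incl
    rintro _ ⟨⟨f, a⟩, hfa, rfl⟩
    have h := subset_carrier_generate T hfa
    rw [mem_carrier_iff] at h ⊢
    -- `h : f ∈ G(T)_a`; goal: `φ f ∈ (G(T).map φ)_a = φ(G(T)_a)S`
    exact Ideal.mem_map_of_mem φ h

/-- Prop. 2.4.2.1 (1) for a filtration given with a set of generators: `𝕀 = G(T) ⇒ 𝕀.map φ = G(φ(T))`.
[cite: Kawanoue2007, Prop. 2.4.2.1 (1)] -/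
theorem IsGeneratedBy.map (φ : R →+* S) {𝕀 : IdealisticFiltration R} {T : Set (R × ℝ)} (h : 𝕀.IsGeneratedBy T) :
    (𝕀.map φ).IsGeneratedBy (Prod.map φ id '' T) := by
  rw [IsGeneratedBy] at h ⊢
  rw [h, map_generate]

/-- «In particular, if `𝕀 = G(T)` is of r.f.g. type, then so are `𝕀_S` and `𝕀̂`» (the image of a finite set of
rational-level generators is again one). [cite: Kawanoue2007, Prop. 2.4.2.1 (1)] -/
theorem IsRFG.map (φ : R →+* S) {𝕀 : IdealisticFiltration R} (h : 𝕀.IsRFG) : (𝕀.map φ).IsRFG := by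
  obtain ⟨T, hT, hq, hgen⟩ := h
  refine ⟨Prod.map φ id '' T, hT.image _, ?_, hgen.map φ⟩
  rintro _ ⟨x, hx, rfl⟩
  exact hq x hx

/-! ## The two printed instances: localization `𝕀_S`, `𝕀_P` and completion `𝕀̂` -/

/-- **Localization `𝕀_S`** of `𝕀` by a multiplicative set `S ⊂ R` [Def. 2.4.1.1 (1)]: the extension along
`R → R_S = Localization S`, levels `(𝕀_a)_S`. [cite: Kawanoue2007, Def. 2.4.1.1 (1)] -/
noncomputable abbrev localization (M : Submonoid R) (𝕀 : IdealisticFiltration R) :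
    IdealisticFiltration (Localization M) :=
  𝕀.map (algebraMap R (Localization M))

/-- **`𝕀_P`**, the localization at the prime `P` («with `S = R ∖ P`, we often denote `𝕀_S` by `𝕀_P`»): the extension
along `R → R_P = Localization.AtPrime P`. [cite: Kawanoue2007, Def. 2.4.1.1 (1)] -/
noncomputable abbrev atPrime (P : Ideal R) [P.IsPrime] (𝕀 : IdealisticFiltration R) :
    IdealisticFiltration (Localization.AtPrime P) :=
  𝕀.map (algebraMap R (Localization.AtPrime P))

/-- **Completion `𝕀̂`** with respect to the `𝔪`-adic topology [Def. 2.4.1.1 (2)]: the extension along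
`R → R̂ = AdicCompletion 𝔪 R`, levels `𝕀_a R̂` (`= 𝕀_a ⊗_R R̂` for `R` noetherian). [cite: Kawanoue2007, Def. 2.4.1.1 (2)] -/
noncomputable abbrev adicCompletion (𝔪 : Ideal R) (𝕀 : IdealisticFiltration R) :
    IdealisticFiltration (AdicCompletion 𝔪 R) :=
  𝕀.map (algebraMap R (AdicCompletion 𝔪 R))

/-- Membership in a level of a localization, for any model `S` of `R_M` (`IsLocalization M S`): `g ∈ (𝕀_M)_a` iff
`g · s = f` in `S` for some `f ∈ 𝕀_a` and `s ∈ M` — i.e. `(𝕀_M)_a = (𝕀_a)_M = {f/s}`. [cite: Kawanoue2007, Def. 2.4.1.1 (1)] -/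
theorem mem_level_map_iff_of_isLocalization (M : Submonoid R) [Algebra R S] [IsLocalization M S]
    (𝕀 : IdealisticFiltration R) {a : ℝ} {g : S} :
    g ∈ (𝕀.map (algebraMap R S)).level a ↔
      ∃ f ∈ 𝕀.level a, ∃ s : M, g * algebraMap R S s = algebraMap R S f := by
  rw [level_map, IsLocalization.mem_map_algebraMap_iff M]
  constructor
  · rintro ⟨⟨⟨f, hf⟩, s⟩, h⟩
    exact ⟨f, hf, s, h⟩
  · rintro ⟨f, hf, s, h⟩
    exact ⟨⟨⟨f, hf⟩, s⟩, h⟩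

/-- `f/1 ∈ (𝕀_M)_a` for `f ∈ 𝕀_a`. [cite: Kawanoue2007, Def. 2.4.1.1 (1)] -/
theorem algebraMap_mem_level_localization (M : Submonoid R) (𝕀 : IdealisticFiltration R) {a : ℝ} {f : R}
    (hf : f ∈ 𝕀.level a) : algebraMap R (Localization M) f ∈ (𝕀.localization M).level a :=
  mem_level_map_of_mem _ 𝕀 hf

/-- Prop. 2.4.2.1 (1) for `𝕀_P`: `G_R(T)_P = G_{R_P}(T)`. [cite: Kawanoue2007, Prop. 2.4.2.1 (1)] -/
theorem atPrime_generate (P : Ideal R) [P.IsPrime] (T : Set (R × ℝ)) :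
    (generate T).atPrime P = generate (Prod.map (algebraMap R (Localization.AtPrime P)) id '' T) :=
  map_generate _ T

/-- Prop. 2.4.2.1 (1) for `𝕀̂`: `Ĝ_R(T) = G_{R̂}(T)`. [cite: Kawanoue2007, Prop. 2.4.2.1 (1)] -/
theorem adicCompletion_generate (𝔪 : Ideal R) (T : Set (R × ℝ)) :
    (generate T).adicCompletion 𝔪 = generate (Prod.map (algebraMap R (AdicCompletion 𝔪 R)) id '' T) :=
  map_generate _ T

end IdealisticFiltration

end Literature.AlgebraicGeometry.Kawanoue2007
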